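import Mathlib
import HarnessLib
import Literature.AlgebraicGeometry.RelativeSpec.FiniteGroupQuotientGenericEtale
import Summits.ResolutionOfSingularities.ResolutionOfSingularities.Theorems.WildQuotientsWildQuotientResolutionS1aTerminalLocus
import Summits.ResolutionOfSingularities.ResolutionOfSingularities.Theorems.WildQuotientsWildQuotientResolutionS1aInvariantNode

/-!
# S1a — (T2e, N6 chart form) A KILLED NODE CHART IS GOOD: `IsGoodAt` from node data with principal augmentation ideal

[OURS · L1 W4.5c · lead-1 g7; T2E-BRIEF (N6)] — NOT statements of the manuscript; counted 0; AI-level work, weaker than expert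
review. Crux stmt-ResolutionOfSingularities-17941, line `s1a-logminvertex` v6, stub `stub_winningStrategy` ((R0) branch: the
one-move step `Wins.of_moves … (Wins.terminal …)` needs `GModel.IsGoodAt` at every point over a killed centre chart).

* `ActionOver.act_eq_self_of_generator` — for `G = ⟨g₀⟩`, a section fixed by `g₀` is fixed by `G`;
* **`GModel.isGoodAt_of_nodeChart_invariants`** — the SCHEME ↔ RING bridge of the `Terminal` clause: if `O ∋ v` is a `G`-stable
  affine open with `e : Γ(V, O) ≃+* A₀` intertwining the action of `g₀` with a ring endomorphism `σ₀` of `A₀`, and the fixed ring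
  `{a | σ₀ a = a}` is a tame root chart, then `M.IsGoodAt v` (the ring of invariants `Γ(O, ⊤)^G` of the quotient-gluing API
  `ActionOver.invariantsRing` is identified with the fixed ring through `Scheme.Opens.ι`, `act_restrict_top_appLE`);
* **`GModel.isGoodAt_of_killedNode`** — a node chart `(O; B, 𝒜, σ, e)` (`NodeAtlas.IsNodeChart` data) whose node is KILLED —
  `augmentationIdeal σ` principal (`…S1aOneShotKillChart(Shift)`) — and of finite type over a Noetherian ring of `σ`-fixed degree-`0`
  elements is GOOD at all its points: the invariant node (`…S1aInvariantNode`, global Király–Lütkebohmert `…S1aInvariantsRegular`).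
-/

set_option linter.dupNamespace false

noncomputable section

open CategoryTheory AlgebraicGeometry TopologicalSpace
open Literature.AlgebraicGeometry.Resolution Literature.AlgebraicGeometry.RelativeSpec
open Summit.ResolutionOfSingularities.ResolutionOfSingularities.Theorems.WildQuotientResolution.S1
open Summit.ResolutionOfSingularities.ResolutionOfSingularities.Theorems.WildQuotientResolution.S1.NodeAtlas
open Summit.ResolutionOfSingularities.ResolutionOfSingularities.Theorems.WildQuotientResolution.S1.ProducerStep
open Summit.ResolutionOfSingularities.ResolutionOfSingularities.Theorems.WildQuotientResolution.S1.InvariantsRegular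

namespace Summit.ResolutionOfSingularities.ResolutionOfSingularities.Theorems.WildQuotientResolution.S1

universe u

/-! ## Fixed by a generator ⇒ fixed by the cyclic group -/

/-- For `G = ⟨g₀⟩`: a section fixed by `g₀` is fixed by every `g ∈ G` (the action on sections is a group action). -/
theorem ActionOver.act_eq_self_of_generator {V Y : Scheme.{u}} {r : V ⟶ Y} {G : Type*} [Group G] (ρ : ActionOver r G)
    {g₀ : G} (hG : ∀ g : G, g ∈ Subgroup.zpowers g₀) (U : Y.Opens) {x : Γ(V, r ⁻¹ᵁ U)} (hx : ρ.act g₀ U x = x)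
    (g : G) : ρ.act g U x = x := by
  have hinv : ρ.act g₀⁻¹ U x = x := by
    have := congrArg (ρ.act g₀⁻¹ U) hx
    rwa [← RingHom.comp_apply, ← ρ.act_mul, inv_mul_cancel, ρ.act_one, RingHom.id_apply, eq_comm] at this
  have key : ∀ k : ℤ, ρ.act (g₀ ^ k) U x = x := by
    intro k
    induction k using Int.induction_on with
    | zero => rw [zpow_zero, ρ.act_one]; rfl
    | succ n ih => rw [zpow_add_one, ρ.act_mul, RingHom.comp_apply, hx, ih]
    | pred n ih => rw [zpow_sub_one, ρ.act_mul, RingHom.comp_apply, hinv, ih]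
  obtain ⟨k, rfl⟩ := Subgroup.mem_zpowers_iff.mp (hG g)
  exact key k

namespace GameFrame.GModel

variable {p : ℕ} {X' X₁ : Scheme.{0}} {q : X' ⟶ X₁} {G : Type} [Group G] {ρ : G →* Aut X'} {g₀ : G}

/-- **SCHEME ↔ RING BRIDGE for the `Terminal` clause.** Let `G = ⟨g₀⟩`, `O ∋ v` a `G`-stable affine open of the model, and
`e : Γ(V, O) ≃+* A₀` a ring isomorphism intertwining the action of `g₀` (pull-back along `g₀⁻¹`, the treeʼs `ActionOver.act`
convention) with an endomorphism `σ₀` of `A₀`. If the fixed ring of `σ₀` is a tame root chart, `M` is GOOD at `v`.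
[OURS · L1 W4.5c] -/
theorem isGoodAt_of_nodeChart_invariants (M : GModel p q G ρ g₀) (hG : ∀ g : G, g ∈ Subgroup.zpowers g₀) (v : M.V)
    (O : M.act.StableAffineOpens) (hv : v ∈ O.1) (hO : IsAffineOpen O.1) {A₀ : Type} [CommRing A₀]
    (e : Γ(M.V, O.1) ≃+* A₀) (σ₀ : A₀ →+* A₀)
    (he : ∀ t : Γ(M.V, O.1), e ((M.act.aut g₀⁻¹).hom.appLE O.1 O.1 (O.2.1 g₀⁻¹).ge t) = σ₀ (e t))
    (h : IsTameRootChart ↥(RingHom.eqLocus σ₀ (RingHom.id A₀))) : M.IsGoodAt v := by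
  refine ⟨O, hv, hO, IsTameRootChart.of_ringEquiv ?_ h⟩
  -- `ψ : Γ(V, O) ≃ Γ(O, ⊤)`
  let ψ : Γ(M.V, O.1) ≃+* Γ(↑O.1, (O.1.ι ≫ M.r) ⁻¹ᵁ ⊤) :=
    (asIso (O.1.ι.appLE O.1 ⊤ O.1.ι_preimage_self.ge)).commRingCatIsoToRingEquiv
  have hψ : ∀ t, ψ t = O.1.ι.appLE O.1 ⊤ O.1.ι_preimage_self.ge t := fun _ => rfl
  -- the action of `g₀` on `Γ(O, ⊤)` in terms of `appLE` on `Γ(V, O)`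
  have hact : ∀ t : Γ(M.V, O.1), (M.act.restrict O.1 O.2.1).act g₀ ⊤ (ψ t) =
      ψ ((M.act.aut g₀⁻¹).hom.appLE O.1 O.1 (O.2.1 g₀⁻¹).ge t) := fun t => by
    rw [hψ, hψ]
    exact (M.act.act_restrict_top_appLE O g₀ t O.1.ι_preimage_self.ge (O.2.1 g₀⁻¹).ge)
  refine (ψ.symm.trans e).restrict ((M.act.restrict O.1 O.2.1).invariantsRing ⊤) (RingHom.eqLocus σ₀ (RingHom.id A₀))
    fun x => ?_
  -- `x` is `G`-invariant iff `e (ψ⁻¹ x)` is `σ₀`-fixed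
  obtain ⟨t, rfl⟩ : ∃ t, ψ t = x := ⟨ψ.symm x, ψ.apply_symm_apply x⟩
  rw [ActionOver.mem_invariantsRing_iff]
  simp only [RingEquiv.coe_trans, Function.comp_apply, RingEquiv.symm_apply_apply, RingHom.mem_eqLocus, RingHom.id_apply]
  rw [← he]
  constructor
  · intro hx
    have h1 := hx g₀
    rw [hact] at h1
    rw [ψ.injective h1]
  · intro hx
    have h1 : (M.act.aut g₀⁻¹).hom.appLE O.1 O.1 (O.2.1 g₀⁻¹).ge t = t := e.injective hx
    have h2 : (M.act.restrict O.1 O.2.1).act g₀ ⊤ (ψ t) = ψ t := by rw [hact, h1]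
    exact fun g => ActionOver.act_eq_self_of_generator (M.act.restrict O.1 O.2.1) hG ⊤ h2 g

/-- **A KILLED NODE CHART IS GOOD.** Let `G = ⟨g₀⟩` and let `O ∋ v` carry node data `(B, 𝒜, σ, e)` as in `IsNodeChart`
(`𝒜` graded by `Π j : Fin m, ZMod (r j)`, `(B, 𝒜, σ)` a tame node at the prime `p`, `e : Γ(V, O) ≃+* 𝒜 0` intertwining
`g₀` with `σ`). If the node is KILLED — `augmentationIdeal σ` is principal — and `B` is of finite type over a Noetherian ring
`R₀` of `σ`-fixed degree-`0` elements, then `M` is good at `v`: the quotient chart `Γ(O, ⊤)^G ≅ (B₀)^σ` is a tame root chart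
by the invariant node (`isTameRootChart_gradeZero_invariants_pi`). [OURS · L1 W4.5c] -/
theorem isGoodAt_of_killedNode (M : GModel p q G ρ g₀) (hG : ∀ g : G, g ∈ Subgroup.zpowers g₀) (hp : p.Prime)
    (v : M.V) (O : M.act.StableAffineOpens) (hv : v ∈ O.1) (hO : IsAffineOpen O.1)
    {m : ℕ} (r : Fin m → ℕ) (B : Type) [CommRing B] (𝒜 : (Π j : Fin m, ZMod (r j)) → AddSubgroup B) [GradedRing 𝒜]
    (σ : B ≃+* B) (e : Γ(M.V, O.1) ≃+* ↥(𝒜 0)) (hnode : IsTameNode p B 𝒜 σ)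
    (he : ∀ t : Γ(M.V, O.1),
      ((e ((M.act.aut g₀⁻¹).hom.appLE O.1 O.1 (O.2.1 g₀⁻¹).ge t) : ↥(𝒜 0)) : B) = σ ((e t : ↥(𝒜 0)) : B))
    (hI : (augmentationIdeal σ).IsPrincipal)
    {R₀ : Type} [CommRing R₀] [IsNoetherianRing R₀] [Algebra R₀ B] [Algebra.FiniteType R₀ B]
    (hσ₀ : ∀ a : R₀, σ (algebraMap R₀ B a) = algebraMap R₀ B a) (h₀ : ∀ a : R₀, algebraMap R₀ B a ∈ 𝒜 0) :
    M.IsGoodAt v := by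
  refine M.isGoodAt_of_nodeChart_invariants hG v O hv hO e
    (((σ : B →+* B).comp (SetLike.GradeZero.subring 𝒜).subtype).codRestrict (SetLike.GradeZero.subring 𝒜)
      (fun x => hnode.2.2.2.2.1 0 x.1 x.2)) (fun t => Subtype.ext (he t)) ?_
  exact isTameRootChart_gradeZero_invariants_pi r 𝒜 σ hp hnode hI hσ₀ h₀

end GameFrame.GModel

end Summit.ResolutionOfSingularities.ResolutionOfSingularities.Theorems.WildQuotientResolution.S1

end
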